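import Mathlib
import Summits.KontsevichZagierPeriods.Zeta5Search.CellKitAffine
import HarnessLib

/-!
# ζ(5) search — gen-2 g13 P.S. (ii): ODD depth on the record ray below `θ = 2` = gen-2 g9's COLLINEARITY CRITERION
# (cell `pub-zeta5`; HONEST FRAMING: systematic search; no irrationality claim unless certified)

`REPORT-gen2-g13.md` §8(c),(g).  Companion of `TypeSpaceWindows` (even depth).  At ODD depth `m = −N` the palindromic frame of g12 never
applies, and the record ray `b(n) = n·(41,17,16,15,14,13,12,11)` meets odd depth below `θ = p/n = 2` at ten lattice positions with `n ≤ 227`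
checked by this seat: (23,41), (60,107), (97,173) `N=29`, (26,41), (45,71), (64,101) `N=33`, (114,167) `N=35`, (116,71), (165,101) `N=83`, (227,107) `N=107`.
At EVERY one of them the first Casoratian digit vanishes by an EXISTING tree theorem, gen-2 g9's `collinearityCriterion_holds`
(`UniversalDigitCells.CollinearityCriterion`: the ORBIT digit vectors `(P_K, P_V)` of the level-`−N` classes lie on one affine line of `𝔽_p²`,
through the origin, or anywhere when `p` is in the moment range `(N−1)p + 2 ≤ 2d + 3`, `d = 25n` — i.e. `θ ≤ 50/(N−1) + O(1/n)`):
* ONE orbit point (line through the origin): (26,41), (45,71), (116,71) — one deep type pair `{T, Tʳᵉᵛ}`; digit-free via census g17's guard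
  `ccGuard` (`ccCount ≤ 1`; `casLB_succ_le_of_ccGuard`); also (64,101), (165,101), where the CENTRE class is deep and its point `σ(c)` COINCIDES
  with the pair point `τ` (two keys, one point: the criterion applies with explicit digits, the guard does not);
* TWO orbit points + moment range: (23,41), (60,107) (two non-central type pairs, `1150 ≤ 1153`, `2998 ≤ 3003`; digit-free: `ccGuard` with
  `ccCount = 2`, `N` odd — P1 g8's `CellKit.affine_bound`), and (97,173), (114,167), (227,107) (centre key + pair keys = three keys but two points,
  `4846 ≤ 4853`, `5680 ≤ 5703`, `11344 ≤ 11353`: explicit digits).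
So the "rank-2 odd instances" left open in REPORT §8(c) are NOT new: orbit-sum rank 2 = two points = an affine line, and the vanishing of the two
full-layer moments `Σ ĝ_x a_x^i`, `i = 0, 2` that the affine case needs is typer g10's theorem `gHatMoments_holds` in the moment range (`g13/oddmoment.py`,
`g13/nodelaw.py`, `g13/g9crit13.py`).  Exact truths (`g12/vpadic.py`): (23,41) −54, (26,41), (45,71), (64,101) −62, (114,167) −66 — all `= casLB + 1`, sharp.
This file: the PROVED pointwise licences at `b = bRec n`, `j = 7` with the numeric conclusion `v ≥ 4 − 2N` (`ccGuard_bRec` digit-free, `collin_bRec`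
with explicit digits), and two guarded window statements (bookkeeping `@[conjecture]` + PROVED reduction): the odd no-centre sublattice `N = 33` of
(41/26, 19/12] and the arc window `N = 29`, [41/23, 25/14].  Guards: `ccRegime (bRec n) p N` (depth exactly `−N` realised — the lattice position, not θ,
decides the depth: (41/26, 19/12] carries `N = 33` at (26,41), (45,71), (64,101) and `N = 34` at ten other primes `n ≤ 150`, which fall under THEOREM A‴)
and `NoDeepCentre`.  `p`-adic valuations of explicit rational numbers; nothing in this file bears on irrationality.
-/

open Finset

namespace Summit.KontsevichZagierPeriods.Zeta5Search.ResidueLaw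

open Summit.KontsevichZagierPeriods.Zeta5Search.ClusterValuation
open Summit.KontsevichZagierPeriods.Zeta5Search.CasoratianValuation (InPolytope shift casoratian)
open Summit.KontsevichZagierPeriods.Zeta5Search.WedgeDictionary (dOf)

/-! ## §1 Record-ray helpers -/

/-- A window prime with `p² > 41n+2`, `n ≥ 2` is at least `5`. -/
private theorem five_le_of_sq₃ (n p : ℕ) (hn : 2 ≤ n) (h : 41 * n + 2 < p ^ 2) : 5 ≤ p := by
  by_contra hc
  have hp4 : p ≤ 4 := by omega
  have : p ^ 2 ≤ 4 ^ 2 := Nat.pow_le_pow_left hp4 2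
  omega

/-- `b₀` of the record ray is `41n`. -/
private theorem bRec_zero₃ (n : ℕ) : bRec n 0 = 41 * (n : ℤ) := by
  simp [bRec]; ring

/-- `d(b(n)) = 25n` on the record ray. -/
private theorem dOf_bRec₃ (n : ℕ) : dOf (bRec n) = 25 * (n : ℤ) := by
  simp [dOf, bRec, Finset.sum_range_succ]; ring

/-! ## §2 The two pointwise licences at a record instance (PROVED) -/

/-- **Census g17's digit-free guard at a record instance (PROVED; `casLB_succ_le_of_ccGuard` + `casLB ≥ 3 − 2N` from `casLB_ge_or_noPole`)**:
`ccGuard (bRec n) p N = true` with `p ≤ 25n = d`, `41n + 2 < p²` gives `v_p(Cas₇(b(n))) ≥ 4 − 2N` (`= casLB + 1`). -/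
theorem ccGuard_bRec (n p N : ℕ) (hn : 2 ≤ n) (hp : p.Prime) (hpn : p ≤ 25 * n) (hsq : 41 * n + 2 < p ^ 2)
    (hG : ccGuard (bRec n) p N = true) (hne : casoratian (bRec n) 7 ≠ 0) :
    (4 : ℤ) - 2 * N ≤ padicValRat p (casoratian (bRec n) 7) := by
  haveI : Fact p.Prime := ⟨hp⟩
  have h5 : 5 ≤ p := five_le_of_sq₃ n p hn hsq
  have hpb : (p : ℤ) ≤ bRec n 0 := by rw [bRec_zero₃]; exact_mod_cast (show p ≤ 41 * n by omega)
  have hpd : (p : ℤ) ≤ dOf (bRec n) := by rw [dOf_bRec₃]; exact_mod_cast hpn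
  have hp2 : (bRec n 0 + 2 : ℤ) < (p : ℤ) ^ 2 := by rw [bRec_zero₃]; exact_mod_cast hsq
  have hcrit := casLB_succ_le_of_ccGuard (bRec n) p 7 N (inPolytope_bRec n)
    (inPolytope_shift_bRec n 7 (by omega) (by norm_num) (by norm_num)) (by norm_num) (by norm_num) hp h5 hpb hpd hp2 hG hne
  have H' := hG
  simp only [ccGuard, Bool.and_eq_true, Bool.or_eq_true, decide_eq_true_eq, beq_iff_eq] at H'
  obtain ⟨hmin, -⟩ := of_decide_eq_true H'.1.1
  have hN : 3 ≤ N := H'.1.2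
  have hLB := casLB_ge_or_noPole (bRec n) p (-(N : ℤ)) (3 - (N : ℤ))
    (fun x hx _ => (hmin x hx).trans (CellA.classExp_le_classNu (bRec n) p x)) (by omega)
    (fun x hx _ => by have := hmin x hx; omega) (fun _ => by omega)
  rcases hLB with ⟨h0, -⟩ | hge
  · rw [h0] at hcrit; omega
  · omega

/-- The hypotheses of `CollinearityCriterion` at `(bRec n, p, N)` WITH EXPLICIT DIGITS: regime H0 (all class exponents `≥ −N`, a multipole class
at `−N`) and an affine line `a·P_K + c·P_V + e ≡ 0 (mod p)` through every deep orbit point, through the origin or with `p` in the moment range.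
Decidable per instance once the digits `ĉ_x, v̂_x mod p` are computed (`g13/g9crit13.py` on light class data; `g9/collinear_check.py` exactly). -/
def RecCollinData (n p N : ℕ) : Prop :=
  (∀ x, x < p → -(N : ℤ) ≤ classExp (bRec n) p x) ∧
  (∃ x ∈ multipoleClasses (bRec n) p, classExp (bRec n) p x = -(N : ℤ)) ∧
  ∃ a c e : ℤ, ¬ ((p : ℤ) ∣ a ∧ (p : ℤ) ∣ c) ∧ (e = 0 ∨ ((N : ℤ) - 1) * p + 2 ≤ 2 * dOf (bRec n) + 3) ∧
    ∀ x ∈ deepClasses (bRec n) p N, pCong p (a * orbitK (bRec n) p N x + c * orbitV (bRec n) p N x + e) = true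

/-- **g9's collinearity criterion at a record instance (PROVED; = `collinearityCriterion_holds` at `b = bRec n`, `j = 7`)**: `RecCollinData n p N`
with `3 ≤ N`, `p ≤ 25n`, `41n + 2 < p²` gives `v_p(Cas₇(b(n))) ≥ 4 − 2N`.  Covers the deep-centre instances (64,101), (165,101) (one point) and
(114,167), (227,107) (two points, moment range), where the digit-free guard `ccGuard` is `false` (two resp. three orbit keys). -/
theorem collin_bRec (n p N : ℕ) (hn : 2 ≤ n) (hp : p.Prime) (hpn : p ≤ 25 * n) (hsq : 41 * n + 2 < p ^ 2) (hN : 3 ≤ N)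
    (hC : RecCollinData n p N) (hne : casoratian (bRec n) 7 ≠ 0) :
    (4 : ℤ) - 2 * N ≤ padicValRat p (casoratian (bRec n) 7) := by
  obtain ⟨hmin, hwit, hline⟩ := hC
  haveI : Fact p.Prime := ⟨hp⟩
  have h5 : 5 ≤ p := five_le_of_sq₃ n p hn hsq
  have hpb : (p : ℤ) ≤ bRec n 0 := by rw [bRec_zero₃]; exact_mod_cast (show p ≤ 41 * n by omega)
  have hpd : (p : ℤ) ≤ dOf (bRec n) := by rw [dOf_bRec₃]; exact_mod_cast hpn
  have hp2 : (bRec n 0 + 2 : ℤ) < (p : ℤ) ^ 2 := by rw [bRec_zero₃]; exact_mod_cast hsq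
  have hcrit := collinearityCriterion_holds (bRec n) p 7 N (inPolytope_bRec n)
    (inPolytope_shift_bRec n 7 (by omega) (by norm_num) (by norm_num)) (by norm_num) (by norm_num) hp h5 hpb hpd hp2 hN hmin hwit hline hne
  have hLB := casLB_ge_or_noPole (bRec n) p (-(N : ℤ)) (3 - (N : ℤ))
    (fun x hx _ => (hmin x hx).trans (CellA.classExp_le_classNu (bRec n) p x)) (by omega)
    (fun x hx _ => by have := hmin x hx; omega) (fun _ => by omega)
  rcases hLB with ⟨h0, -⟩ | hge
  · rw [h0] at hcrit; omega
  · omega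

/-! ## §3 Two guarded windows (bookkeeping `@[conjecture]` + PROVED reduction) -/

/-- CENTRE GUARD: no class containing the centre sits at the bottom exponent `−N`.  On the `N = 33` sublattice of (41/26, 19/12] this selects
(26,41), (45,71) and excludes (64,101) (deep centre class: `ccGuard` false, covered pointwise by `collin_bRec` — all three orbit points coincide,
`(P_K, P_V) ≡ (14, 9) mod 101`; exact truth −62). -/
def NoDeepCentre (n p N : ℕ) : Prop := ∀ x, x < p → CentreIn (bRec n) p x → -(N : ℤ) < classExp (bRec n) p x

/-- Bookkeeping, odd no-centre sublattice `N = 33` of (41/26, 19/12]: census g17's guard holds (ONE orbit key: one deep orbit at (26,41), two deep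
orbits of one type pair at (45,71) — `g13/g9crit13.py`, `g13/oddorbit.py`; the ten other window primes with `n ≤ 150` have `N = 34` and are excluded
by the regime guard, (64,101) by the centre guard). -/
@[conjecture] def RecCCGuardM33 : Prop :=
  ∀ n p : ℕ, 2 ≤ n → p.Prime → 41 * n < 26 * p → 12 * p ≤ 19 * n → 41 * n + 2 < p ^ 2 →
    ccRegime (bRec n) p 33 = true → NoDeepCentre n p 33 → ccGuard (bRec n) p 33 = true

/-- **RECORD WINDOW, odd no-centre sublattice `N = 33` of `(41/26, 19/12]`** (casLB = −63): `v_p(Cas₇(b(n))) ≥ −62` (exact truth at (26,41),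
(45,71); the `N = 34` sublattice reaches the same −62 by THEOREM A‴, and (64,101) by `collin_bRec`). -/
@[conjecture] def RecWindowOddM33 : Prop :=
  ∀ n p : ℕ, 2 ≤ n → p.Prime → 41 * n < 26 * p → 12 * p ≤ 19 * n → 41 * n + 2 < p ^ 2 →
    ccRegime (bRec n) p 33 = true → NoDeepCentre n p 33 →
    casoratian (bRec n) 7 ≠ 0 → (-62 : ℤ) ≤ padicValRat p (casoratian (bRec n) 7)

/-- **`RecCCGuardM33 → RecWindowOddM33`** (PROVED reduction, bookkeeping ALONE — the law is the tree theorem `collinearityCriterion_holds`). -/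
theorem recWindowOddM33_of (hS : RecCCGuardM33) : RecWindowOddM33 := by
  intro n p hn hp h1 h2 h3 hR hN hne
  have key := ccGuard_bRec n p 33 hn hp (by omega) h3 (hS n p hn hp h1 h2 h3 hR hN) hne
  have e : (4 : ℤ) - 2 * ((33 : ℕ) : ℤ) = -62 := by norm_num
  rw [e] at key; exact key

/-- Bookkeeping, ARC window `N = 29`, [41/23, 25/14] (upper edge = the moment-range edge `θ = 50/28`; CLOSED at g11's breakpoint `41/23` so as to
include (23,41), which carries the window's exponents `(e_proved, e_G) = (4, 3)`): on the no-centre `N = 29` sublattice census g17's guard holds — two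
non-central deep type pairs (two orbit points), `N` odd, `p` in the moment range (`28p + 2 ≤ 50n + 3`).  Verified (`g13/g9crit13.py`,
`g13/g9crit13_win_M29.txt`, window primes `n ≤ 150`) at both realised no-centre instances: (23,41) (keys 2, points (22,6), (35,33) mod 41, `1150 ≤ 1153`;
exact truth −54 = casLB + 1) and (60,107) (keys 2, `2998 ≤ 3003`).  Excluded by the guards: (97,173) (`N = 29`, deep CENTRE class — three keys, two
points, `4846 ≤ 4853`: `collin_bRec` applies, −54) and the six `N = 30` primes (88,157), (107,191), (125,223), (134,239), (135,241), (144,257) (even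
sublattice; there `ccGuard` holds with ONE key, giving `casLB + 1 = −56` only).  The window is lattice-mixed like (41/26, 19/12]. -/
@[conjecture] def RecCCGuardM29 : Prop :=
  ∀ n p : ℕ, 2 ≤ n → p.Prime → 41 * n ≤ 23 * p → 14 * p ≤ 25 * n → 41 * n + 2 < p ^ 2 →
    ccRegime (bRec n) p 29 = true → NoDeepCentre n p 29 → ccGuard (bRec n) p 29 = true

/-- **RECORD WINDOW, arc window `N = 29`, `[41/23, 25/14]`, no-centre sublattice** (casLB = −55): `v_p(Cas₇(b(n))) ≥ −54` (exact truth at (23,41)). -/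
@[conjecture] def RecWindowOddM29 : Prop :=
  ∀ n p : ℕ, 2 ≤ n → p.Prime → 41 * n ≤ 23 * p → 14 * p ≤ 25 * n → 41 * n + 2 < p ^ 2 →
    ccRegime (bRec n) p 29 = true → NoDeepCentre n p 29 →
    casoratian (bRec n) 7 ≠ 0 → (-54 : ℤ) ≤ padicValRat p (casoratian (bRec n) 7)

/-- **`RecCCGuardM29 → RecWindowOddM29`** (PROVED reduction, bookkeeping ALONE). -/
theorem recWindowOddM29_of (hS : RecCCGuardM29) : RecWindowOddM29 := by
  intro n p hn hp h1 h2 h3 hR hN hne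
  have key := ccGuard_bRec n p 29 hn hp (by omega) h3 (hS n p hn hp h1 h2 h3 hR hN) hne
  have e : (4 : ℤ) - 2 * ((29 : ℕ) : ℤ) = -54 := by norm_num
  rw [e] at key; exact key

end Summit.KontsevichZagierPeriods.Zeta5Search.ResidueLaw
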